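import Summits.QuantumFields.BalabanUV.T4Continuum.Support.TermwiseHolderNorm
import Literature.MathematicalPhysics.QuantumFieldTheory.Balaban1983to89.B11Thm1

/-!
# TermwiseHolder (part 6) — the background binder `hA9` DOWNSTREAM of the tree's typed statement of
[Balaban1985Variational] Theorem 1 (`B11Thm1.Thm1At`): a realisation dictionary, ONE CALL

HONEST FRAMING, PLACEMENT, ABSOLUTE RULE: see part 1/4 (`Support/TermwiseHolder`): FIXED FINITE four-torus, rung
(B)+1, conditional; NOT infinite volume, NOT a mass gap, NOT the Clay statement; the spine estimate NE7 is NOT PRINTED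
in [Balaban1984PropagatorsI]–[Balaban1989LargeFieldII] and NOT proved here; every hypothesis is a NAMED binder.  Cell
`pub-balaban`, lineage `b2b-balaban-t4-ne7-p1` (generation 16), record `t4/T4-EST-NE7-P1.md` §20 (20j).  No sentence of
print is used as a fact: the tree's typed Theorem 1 (`B11.Regularity`, `B11Thm1.Thm1At`, cell papers' reader r2 and
surge node pv12, abstract carrier `B11.VarProblem`) enters as a HYPOTHESIS (`hT : Thm1At C P`), exactly as its home
module uses it; the located gaps of that skeleton (cell GAPS G-B11-A1/A2, C-pv12-2, G-pv12-1, C-B8-18, G-B11-F3a) are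
untouched and not re-adjudicated here.

THE POINT (trigger (t2) of the generation-15 HANDOFF, made precise).  Part 5 typed the background binder of the
term-wise chain in the printed currency: `hA9 : ∀ …, ∀ z, HolderReg (V_K …) z 6 (L^K)⁻¹ (a₀ε₁) (a₁ε₁) β₀ (a₂ε₁)`
(|A| ≤ a₀ε₁, |∇^ηA| ≤ a₁ε₁, ‖A‖_{1,β₀} ≤ a₂ε₁ in the sense of [Balaban1985BackgroundPropagators] (3.40) at U₀ = 1, about
every site, at the top level).  The tree ALREADY holds Theorem 1 of [Balaban1985Variational] as a typed statement
over an abstract carrier: `B11.VarProblem` with uninterpreted fields `Gauged U □`, `normA U □` (= |A| on □),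
`normGradA U □` (= |∇^ηA|), `holderA U □ β` (= ‖A‖_{1,β}) — r2's docstring: *"`Gauged U □` : existence of the gauge
transformation u of the theorem on a neighbourhood of □ with U^{u⁻¹} = e^{iηA}, and the sup-norms on □ of that A"* —
and `B11Thm1.Thm1At C P` (Theorem 1 at given constants `C : Consts`, chosen BEFORE the instance).  THIS PART supplies
the one missing piece between the two: a REALISATION of the abstract carrier on the lineage's concrete lattice
(`Realises P`: a concrete configuration `cfg U`, a centre and an `l¹`-radius for every cube, and the statement that
the gauge `u` and potential of `Gauged U □` represent `cfg U` on that ball with the abstract numbers `normA`,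
`normGradA`, `holderA` as upper bounds of the concrete size / first-difference / (3.40)-Hölder quantities — the
SEMANTICS r2 left abstract, displayed as a structure, never asserted of any particular `P`), and proves, ONE CALL each:
`holderReg_of_regularity` (`B11.Regularity P B₃ B₄ ε₁ U □` ⇒ `HolderReg (cfg U) (centre □) (radius □) η
(B₃Mε₁t) (B₃Mε₁t²) β₀ (B₄Mε₁t^{2+β₀})`, `t = (L^jη)⁻¹`, any `0 ≤ β₀ ≤ 1`, strict `<` weakened to `≤`),
`holderReg_of_thm1At` (the same from `Thm1At C P` for a configuration on the minimal orbit and a cube of the class with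
`sizeM □ ≤ M(ε₁)`), `HolderReg.recentre` (ball inclusion), and `holderReg_everySite_of_thm1At` (with a displayed
top-level COVERING binder — every site lies `6`-deep in the ball of some admissible cube with `L^jη = 1` and
`sizeM □ ≤ Mc` — the binder `hA9`'s body for ONE configuration: `∀ z, HolderReg (cfg U) z 6 η (B₃Mcε₁) (B₃Mcε₁) β₀
(B₄Mcε₁)`), finally `holderReg_family_of_thm1At` for a FAMILY of problems indexed by the cutoff `K` with
`η_K = (L^K)⁻¹` and ONE block of constants (r2's quantifier order: constants before the instance) — literally the shape
of `hA9` with `a₀ = a₁ = B₃Mc`, `a₂ = B₄Mc`, `K`-uniform.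

v1.1 (same generation, APPEND-ONLY §15; every v1 declaration byte-identical): `HolderReg.mono_eta` (monotone in the
spacing slot) and `holderReg_family_of_thm1At_le` (`η_K ≤ (L^K)⁻¹`: run B's level-`K+1` problems as well as run A's —
the body of `hB9` too).

WHAT THIS DOES AND DOES NOT DO.  It makes the background binder of the all-small-field history's action-kind matching
(record (20i): the typed chain is exactly that history's) FORMALLY DOWNSTREAM of the tree's typed Theorem 1: `hA9` ⇐
`Thm1At` (per run, per cutoff) + a realisation + a covering + the identification of the ledger's background variable
`VA K t τ v` with the realised minimiser ((repr)-class, the consumer's).  It does NOT prove Theorem 1, does NOT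
instantiate `VarProblem` on Bałaban's objects (none are constructed in the tree), does NOT touch the β₀ = 1 question
(the kernel admits any `0 ≤ β₀ ≤ 1`; print derivable `< 1`, C-B8-18), and asserts nothing printed.  [folklore]
bookkeeping; NOT NE7, NOT summit progress.
-/

noncomputable section

open Finset MeasureTheory _root_.Filter _root_.Topology NormedSpace
open scoped BigOperators Matrix.Norms.L2Operator InnerProductSpace

namespace Summit.QuantumFields.BalabanUV.T4Continuum.TermwiseHolder

open Literature.MathematicalPhysics.QuantumFieldTheory.Balaban1983to89
open B7Prop1Explicit TermwiseBackground B11HolderComplex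
open B11 (VarProblem Regularity)

/-! ## §13 Realisation of the abstract carrier on the concrete lattice -/

section Realise

variable {d : ℕ} {𝔸 : Type*} [NormedRing 𝔸] [NormOneClass 𝔸] [NormedAlgebra ℂ 𝔸] [CompleteSpace 𝔸]

/-- **REALISATION of r2's abstract carrier `B11.VarProblem` on the concrete lattice** (the SEMANTICS of its
uninterpreted fields, displayed as data + one statement; never asserted of any particular `P`).  `cfg U` is the
concrete bond configuration of the abstract configuration `U`; every cube `□` has a centre and an `l¹`-radius (its
concrete extent); and `gauge`: whenever `P.Gauged U □` (*"there exists a gauge transformation u defined on a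
neighborhood of □ and such that on □, U^{u⁻¹} = e^{iηA}"*), there are norm-bounded gauge units `u` and a potential
`B = ηA` representing `cfg U` on the ball, with `‖B‖ ≤ η·normA U □` (*"|A|"*), `‖Δ_μB_ν‖ ≤ η²·normGradA U □`
(*"|∇^ηA|"*), and for every `0 ≤ β ≤ 1` the first-difference family `(η²·holderA U □ β, β)`-Hölder over the pairs of
the ball at physical distance `η|x′−x|₁ ≤ 1` (*"‖A‖_{1,β}"* in the sense of (3.40) at `U₀ = 1`, part 5). [folklore] -/
structure Realises (P : VarProblem) (d : ℕ) (𝔸 : Type*) [NormedRing 𝔸] [NormOneClass 𝔸] [NormedAlgebra ℂ 𝔸]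
    [CompleteSpace 𝔸] where
  /-- the concrete bond configuration of an abstract configuration -/
  cfg : P.Cfg → B7Prop1Explicit.Site d → Fin d → 𝔸ˣ
  /-- the centre of a cube of the class -/
  centre : P.Cube → B7Prop1Explicit.Site d
  /-- the `l¹`-radius of the ball inside the cube on which the representation is read -/
  radius : P.Cube → ℕ
  /-- the gauge and potential of `Gauged U □` realise `cfg U` on the ball with the abstract norms as bounds -/
  gauge : ∀ (U : P.Cfg) (c : P.Cube), P.Gauged U c →
    ∃ (u : B7Prop1Explicit.Site d → 𝔸ˣ) (B : B7Prop1Explicit.Site d → Fin d → 𝔸),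
      (∀ x, u x ∈ U1 𝔸) ∧
      (∀ x κ, l1 (x - centre c) ≤ radius c → cfg U x κ = gaugeAct u (fun y ι => expUnit (B y ι)) x κ) ∧
      (∀ x κ, l1 (x - centre c) ≤ radius c → ‖B x κ‖ ≤ P.eta * P.normA U c) ∧
      (∀ x κ ι, l1 (x - centre c) ≤ radius c → ‖B (x + e ι) κ - B x κ‖ ≤ P.eta ^ 2 * P.normGradA U c) ∧
      (∀ β : ℝ, 0 ≤ β → β ≤ 1 →
        HolderOn (fun x x' => P.eta * (l1 (x' - x) : ℝ)) β
          (fun x x' => (l1 (x - centre c) ≤ radius c ∧ l1 (x' - centre c) ≤ radius c) ∧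
            P.eta * (l1 (x' - x) : ℝ) ≤ 1)
          (fun x (p : Fin d × Fin d) => B (x + e p.1) p.2 - B x p.2) (P.eta ^ 2 * P.holderA U c β))

/-- **`Regularity` ⇒ `HolderReg` (one cube).**  r2's `B11.Regularity P B₃ B₄ ε₁ U □` (= `Gauged` ∧ (9) ∧ (10), with
`t = (L^jη)⁻¹`: `normA < B₃Mε₁t`, `normGradA < B₃Mε₁t²`, `holderA β < B₄Mε₁t^{2+β}` for `0 ≤ β ≤ 1`) and a realisation
with `0 ≤ η` give, for every `0 ≤ β₀ ≤ 1`, `HolderReg (cfg U) (centre □) (radius □) η (B₃Mε₁t) (B₃Mε₁t²) β₀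
(B₄Mε₁t^{2+β₀})` (strict `<` weakened to `≤`; the (10) clause is not used). [folklore] -/
theorem holderReg_of_regularity {P : VarProblem} (ρ : Realises P d 𝔸) (hη : 0 ≤ P.eta) {B₃ B₄ ε₁ : ℝ}
    {U : P.Cfg} {c : P.Cube} (hreg : Regularity P B₃ B₄ ε₁ U c) {β₀ : ℝ} (hβ₀ : 0 ≤ β₀) (hβ₀1 : β₀ ≤ 1) :
    HolderReg (ρ.cfg U) (ρ.centre c) (ρ.radius c) P.eta
      (B₃ * P.sizeM c * ε₁ * (P.L ^ P.scale c * P.eta)⁻¹ ^ 1)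
      (B₃ * P.sizeM c * ε₁ * (P.L ^ P.scale c * P.eta)⁻¹ ^ 2) β₀
      (B₄ * P.sizeM c * ε₁ * ((P.L ^ P.scale c * P.eta)⁻¹) ^ (2 + β₀)) := by
  obtain ⟨hG, h9a, h9b, h9c, -⟩ := hreg
  obtain ⟨u, B, hu, hrep, hB₀, hB₁, hH⟩ := ρ.gauge U c hG
  refine ⟨u, B, hu, hrep, fun x κ hx => (hB₀ x κ hx).trans ?_, fun x κ ι hx => (hB₁ x κ ι hx).trans ?_, ?_⟩
  · exact mul_le_mul_of_nonneg_left h9a.le hη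
  · exact mul_le_mul_of_nonneg_left h9b.le (sq_nonneg _)
  · exact (hH β₀ hβ₀ hβ₀1).mono (fun x x' => by positivity)
      (mul_le_mul_of_nonneg_left (h9c β₀ hβ₀ hβ₀1).le (sq_nonneg _))

/-- **Theorem 1 (typed, `B11Thm1.Thm1At`) ⇒ `HolderReg` on every admissible cube.**  For `ε₁ ∈ (0, a₁]`, a datum `V`
with (7), a configuration `U` on the minimal orbit of (8), and a cube of the class with `sizeM □ ≤ M(ε₁)`:
`HolderReg (cfg U) (centre □) (radius □) η (B₃Mε₁t) (B₃Mε₁t²) β₀ (B₄Mε₁t^{2+β₀})`, any `0 ≤ β₀ ≤ 1` — ONE CALL of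
`hT`'s regularity clause and `holderReg_of_regularity`.  `hT` is a HYPOTHESIS (the tree's typed Theorem 1, whose
printed proof the cell audits elsewhere); nothing printed is asserted. [folklore] -/
theorem holderReg_of_thm1At {P : VarProblem} (ρ : Realises P d 𝔸) (hη : 0 ≤ P.eta) (C : B11Thm1.Consts)
    (hT : B11Thm1.Thm1At C P) {ε₁ : ℝ} (hε₁ : 0 < ε₁) (hε₁a : ε₁ ≤ C.a₁) {V : P.Bdry} (hV : P.Reg7 ε₁ V)
    {U : P.Cfg} (hU : P.OnMinimalOrbit (C.B₃ * ε₁) V U) {c : P.Cube} (hc : P.sizeM c ≤ C.Mfun ε₁)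
    {β₀ : ℝ} (hβ₀ : 0 ≤ β₀) (hβ₀1 : β₀ ≤ 1) :
    HolderReg (ρ.cfg U) (ρ.centre c) (ρ.radius c) P.eta
      (C.B₃ * P.sizeM c * ε₁ * (P.L ^ P.scale c * P.eta)⁻¹ ^ 1)
      (C.B₃ * P.sizeM c * ε₁ * (P.L ^ P.scale c * P.eta)⁻¹ ^ 2) β₀
      (C.B₄ * P.sizeM c * ε₁ * ((P.L ^ P.scale c * P.eta)⁻¹) ^ (2 + β₀)) :=
  holderReg_of_regularity ρ hη ((hT ε₁ hε₁ hε₁a V hV).2.2 U hU c hc) hβ₀ hβ₀1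

/-- **Re-centring** (ball inclusion): `HolderReg` about `z` with radius `R` gives `HolderReg` about any `z′` with radius
`R′` as soon as `|z′ − z|₁ + R′ ≤ R`. [folklore] -/
theorem HolderReg.recentre {V : B7Prop1Explicit.Site d → Fin d → 𝔸ˣ} {z z' : B7Prop1Explicit.Site d} {R R' : ℕ}
    {η c₀ c₁ β c₂ : ℝ} (h : HolderReg V z R η c₀ c₁ β c₂) (hzz : l1 (z' - z) + R' ≤ R) :
    HolderReg V z' R' η c₀ c₁ β c₂ := by
  have hball : ∀ x : B7Prop1Explicit.Site d, l1 (x - z') ≤ R' → l1 (x - z) ≤ R := fun x hx => by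
    have h1 := l1_add_le (x - z') (z' - z)
    rw [show x - z' + (z' - z) = x - z by abel] at h1
    omega
  obtain ⟨u, B, hu, hrep, hB₀, hB₁, hH⟩ := h
  exact ⟨u, B, hu, fun x κ hx => hrep x κ (hball x hx), fun x κ hx => hB₀ x κ (hball x hx),
    fun x κ ι hx => hB₁ x κ ι (hball x hx),
    fun x x' hP => hH x x' ⟨⟨hball x hP.1.1, hball x' hP.1.2⟩, hP.2⟩⟩

/-- **`hA9`'s body for ONE configuration, from the typed Theorem 1.**  Data: a realisation; `Thm1At C P`; `ε₁ ∈ (0, a₁]`,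
`V` with (7), `U` on the minimal orbit; and a TOP-LEVEL COVERING (displayed binder `hcover`): every site `z` lies
`6`-deep in the ball of some cube `□` of the class at the top level (`L^jη = 1`) with `sizeM □ ≤ Mc ≤ M(ε₁)` (on a torus
large against `2Mc + 4R₁M₁` every site is so covered — geometry of pp. 278–279, NOT formalised).  CONCLUSION: for every
`0 ≤ β₀ ≤ 1`, `∀ z, HolderReg (cfg U) z 6 η (B₃Mcε₁) (B₃Mcε₁) β₀ (B₄Mcε₁)` — the body of the ledger binder `hA9` of
part 5 for this configuration, with `a₀ = a₁ = B₃Mc`, `a₂ = B₄Mc` (`0 ≤ B₃, B₄`, `0 ≤ η`). [folklore] -/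
theorem holderReg_everySite_of_thm1At {P : VarProblem} (ρ : Realises P d 𝔸) (hη : 0 ≤ P.eta) (C : B11Thm1.Consts)
    (hT : B11Thm1.Thm1At C P) {ε₁ : ℝ} (hε₁ : 0 < ε₁) (hε₁a : ε₁ ≤ C.a₁) {V : P.Bdry} (hV : P.Reg7 ε₁ V)
    {U : P.Cfg} (hU : P.OnMinimalOrbit (C.B₃ * ε₁) V U) {Mc : ℝ} (hMc : Mc ≤ C.Mfun ε₁)
    (hcover : ∀ z : B7Prop1Explicit.Site d, ∃ c : P.Cube,
      P.L ^ P.scale c * P.eta = 1 ∧ P.sizeM c ≤ Mc ∧ l1 (z - ρ.centre c) + 6 ≤ ρ.radius c)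
    {β₀ : ℝ} (hβ₀ : 0 ≤ β₀) (hβ₀1 : β₀ ≤ 1) :
    ∀ z : B7Prop1Explicit.Site d,
      HolderReg (ρ.cfg U) z 6 P.eta (C.B₃ * Mc * ε₁) (C.B₃ * Mc * ε₁) β₀ (C.B₄ * Mc * ε₁) := by
  intro z
  obtain ⟨c, htop, hMc', hz⟩ := hcover z
  have h := holderReg_of_thm1At ρ hη C hT hε₁ hε₁a hV hU (hMc'.trans hMc) hβ₀ hβ₀1 (c := c)
  simp only [htop, inv_one, one_pow, Real.one_rpow, mul_one] at h
  refine (h.recentre hz).mono hη ?_ ?_ ?_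
  · exact mul_le_mul_of_nonneg_right (mul_le_mul_of_nonneg_left hMc' C.B₃_pos.le) hε₁.le
  · exact mul_le_mul_of_nonneg_right (mul_le_mul_of_nonneg_left hMc' C.B₃_pos.le) hε₁.le
  · exact mul_le_mul_of_nonneg_right (mul_le_mul_of_nonneg_left hMc' C.B₄_pos.le) hε₁.le

/-- **THE FAMILY FORM — the shape of `hA9`, `K`-uniform constants** (r2's quantifier order: ONE block of constants
`C` before the instance).  A family of variational problems `fam K` (run A's level-`K` problem at cutoff `K`, say) with
`η_K = (L^K)⁻¹`, realisations `ρ K`, the typed Theorem 1 at the SAME constants for every `K` (`∀ K, Thm1At C (fam K)` —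
`B11Thm1.thm1Printed_iff`), `ε₁ ∈ (0, a₁]`, data `V K` with (7), configurations `U K` on the minimal orbits, one size
bound `Mc ≤ M(ε₁)` and top-level coverings for every `K`.  CONCLUSION: `∀ K z, HolderReg ((ρ K).cfg (U K)) z 6
((L^K)⁻¹) (B₃Mcε₁) (B₃Mcε₁) β₀ (B₄Mcε₁)` — i.e. the ledger binder `hA9` of part 5 for the background `K ↦ (ρ K).cfg
(U K)` with `a₀ = a₁ = B₃Mc`, `a₂ = B₄Mc` independent of `K`.  What a consumer still supplies BY NAME: the
identification of the ledger's `VA K t τ v` with this background ((repr)-class), the realisations, the coverings, and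
`hT` itself. [folklore] -/
theorem holderReg_family_of_thm1At (L : ℕ) (fam : ℕ → VarProblem) (ρ : ∀ K, Realises (fam K) d 𝔸)
    (heta : ∀ K, (fam K).eta = ((L : ℝ) ^ K)⁻¹) (C : B11Thm1.Consts) (hT : ∀ K, B11Thm1.Thm1At C (fam K))
    {ε₁ : ℝ} (hε₁ : 0 < ε₁) (hε₁a : ε₁ ≤ C.a₁) (V : ∀ K, (fam K).Bdry) (hV : ∀ K, (fam K).Reg7 ε₁ (V K))
    (U : ∀ K, (fam K).Cfg) (hU : ∀ K, (fam K).OnMinimalOrbit (C.B₃ * ε₁) (V K) (U K))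
    {Mc : ℝ} (hMc : Mc ≤ C.Mfun ε₁)
    (hcover : ∀ K (z : B7Prop1Explicit.Site d), ∃ c : (fam K).Cube,
      (fam K).L ^ (fam K).scale c * (fam K).eta = 1 ∧ (fam K).sizeM c ≤ Mc ∧
        l1 (z - (ρ K).centre c) + 6 ≤ (ρ K).radius c)
    {β₀ : ℝ} (hβ₀ : 0 ≤ β₀) (hβ₀1 : β₀ ≤ 1) :
    ∀ (K : ℕ) (z : B7Prop1Explicit.Site d),
      HolderReg ((ρ K).cfg (U K)) z 6 (((L : ℝ) ^ K)⁻¹) (C.B₃ * Mc * ε₁) (C.B₃ * Mc * ε₁) β₀ (C.B₄ * Mc * ε₁) := by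
  intro K z
  have hη : 0 ≤ (fam K).eta := by rw [heta K]; positivity
  rw [← heta K]
  exact holderReg_everySite_of_thm1At (ρ K) hη C (hT K) hε₁ hε₁a (hV K) (hU K) hMc (hcover K) hβ₀ hβ₀1 z

end Realise

/-! ## §14 Toy: the trivial variational problem realised by the constant configuration -/

section Toy

/-- A one-point variational problem (one configuration, one cube at the top scale `L^0·η = η = 1`, all norms `0`):
a carrier on which `Regularity` holds for positive constants — used only to show the §13 hypotheses are jointly
satisfiable. [folklore] -/
def toyProblem : VarProblem where
  Cfg := Unit
  Bdry := Unit
  Cube := Unit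
  scale := fun _ => 0
  sizeM := fun _ => 1
  eta := 1
  L := 2
  InU := fun _ _ => True
  InB := fun _ _ => True
  Reg7 := fun _ _ => True
  OnMinimalOrbit := fun _ _ _ => True
  UniqueCriticalOrbit := fun _ _ _ => True
  Gauged := fun _ _ => True
  normA := fun _ _ => 0
  normGradA := fun _ _ => 0
  holderA := fun _ _ _ => 0
  normLapA := fun _ _ => 0

/-- The constant `U(3)` configuration on `ℤ⁴` realises `toyProblem` about the origin with any radius (`u ≡ 1`,
`B ≡ 0`). [folklore] -/
def toyRealises (R : ℕ) : Realises toyProblem 4 (Matrix (Fin 3) (Fin 3) ℂ) where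
  cfg := fun _ _ _ => 1
  centre := fun _ => 0
  radius := fun _ => R
  gauge := fun _ _ _ => by
    have h0 : expUnit (0 : Matrix (Fin 3) (Fin 3) ℂ) = 1 := Units.ext (by simp)
    refine ⟨fun _ => 1, fun _ _ => 0, fun _ => Subgroup.one_mem _, fun x κ _ => by simp [gaugeAct, h0], ?_, ?_, ?_⟩
    · intro x κ _; simp [toyProblem]
    · intro x κ ι _; simp [toyProblem]
    · intro β _ _ x x' _; simp [toyProblem]

/-- `Regularity` holds on the toy carrier for any positive `B₃, B₄, ε₁` (all abstract norms vanish). [folklore] -/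
theorem toy_regularity {B₃ B₄ ε₁ : ℝ} (hB₃ : 0 < B₃) (hB₄ : 0 < B₄) (hε₁ : 0 < ε₁) (U : toyProblem.Cfg)
    (c : toyProblem.Cube) : Regularity toyProblem B₃ B₄ ε₁ U c := by
  refine ⟨trivial, ?_, ?_, ?_, ?_⟩ <;> simp only [toyProblem] <;> intros <;> positivity

/-- Non-vacuity of §13: on the toy carrier the dictionary yields `HolderReg` of the constant configuration about the
origin with the (9)-type constants (`t = 1`). [folklore] -/
example {B₃ B₄ ε₁ : ℝ} (hB₃ : 0 < B₃) (hB₄ : 0 < B₄) (hε₁ : 0 < ε₁) :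
    HolderReg (fun (_ : B7Prop1Explicit.Site 4) (_ : Fin 4) => (1 : (Matrix (Fin 3) (Fin 3) ℂ)ˣ)) 0 7 1
      (B₃ * 1 * ε₁ * ((2 : ℝ) ^ 0 * 1)⁻¹ ^ 1) (B₃ * 1 * ε₁ * ((2 : ℝ) ^ 0 * 1)⁻¹ ^ 2) (1 / 2)
      (B₄ * 1 * ε₁ * (((2 : ℝ) ^ 0 * 1)⁻¹) ^ (2 + (1 / 2 : ℝ))) :=
  holderReg_of_regularity (toyRealises 7) (by norm_num [toyProblem]) (toy_regularity hB₃ hB₄ hε₁ () ())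
    (by norm_num) (by norm_num)

end Toy

/-! ## §15 (v1.1, append-only) Monotonicity in the spacing and the run-B form of the family theorem

Run B's level-`K+1` problem has spacing `η = (L^{K+1})⁻¹ ≤ (L^K)⁻¹`, while the ledger binder `hB9` of part 5 is
read at the spacing slot `(L^K)⁻¹` like `hA9`.  `HolderReg` is MONOTONE in its spacing slot (for non-negative
constants and exponent): a finer spacing asks the Hölder clause on MORE pairs with a SMALLER bound, so the clause at a
coarser slot follows.  Hence the family theorem with `η_K ≤ (L^K)⁻¹` — the shape of `hB9` as well. -/

section RunB

variable {d : ℕ} {𝔸 : Type*} [NormedRing 𝔸] [NormOneClass 𝔸] [NormedAlgebra ℂ 𝔸] [CompleteSpace 𝔸]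

/-- **`HolderReg` is monotone in the spacing slot**: `0 ≤ η′ ≤ η`, non-negative constants and exponent:
`HolderReg V z R η′ c₀ c₁ β c₂ → HolderReg V z R η c₀ c₁ β c₂` (size and first differences: `η′c₀ ≤ ηc₀`,
`η′²c₁ ≤ η²c₁`; Hölder: the pairs with `η|x′−x|₁ ≤ 1` are among those with `η′|x′−x|₁ ≤ 1`, and
`η′²c₂(η′ρ)^β ≤ η²c₂(ηρ)^β`). [folklore] -/
theorem HolderReg.mono_eta {V : B7Prop1Explicit.Site d → Fin d → 𝔸ˣ} {z : B7Prop1Explicit.Site d} {R : ℕ}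
    {η η' c₀ c₁ β c₂ : ℝ} (h : HolderReg V z R η' c₀ c₁ β c₂) (hη'0 : 0 ≤ η') (hη : η' ≤ η)
    (hc₀ : 0 ≤ c₀) (hc₁ : 0 ≤ c₁) (hβ : 0 ≤ β) (hc₂ : 0 ≤ c₂) :
    HolderReg V z R η c₀ c₁ β c₂ := by
  obtain ⟨u, B, hu, hrep, hB₀, hB₁, hH⟩ := h
  have hη0 : 0 ≤ η := hη'0.trans hη
  have hsq : η' ^ 2 ≤ η ^ 2 := pow_le_pow_left₀ hη'0 hη 2
  refine ⟨u, B, hu, hrep, fun x κ hx => (hB₀ x κ hx).trans (mul_le_mul_of_nonneg_right hη hc₀),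
    fun x κ ι hx => (hB₁ x κ ι hx).trans (mul_le_mul_of_nonneg_right hsq hc₁), ?_⟩
  intro x x' hP
  obtain ⟨hballs, hdist⟩ := hP
  have hl1 : (0 : ℝ) ≤ (l1 (x' - x) : ℝ) := Nat.cast_nonneg _
  have hρ : η' * (l1 (x' - x) : ℝ) ≤ η * (l1 (x' - x) : ℝ) := mul_le_mul_of_nonneg_right hη hl1
  have hρ0 : 0 ≤ η' * (l1 (x' - x) : ℝ) := mul_nonneg hη'0 hl1
  have h1 := hH x x' ⟨hballs, hρ.trans hdist⟩
  dsimp only at h1 ⊢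
  refine h1.trans ?_
  exact mul_le_mul (mul_le_mul_of_nonneg_right hsq hc₂) (Real.rpow_le_rpow hρ0 hρ hβ)
    (Real.rpow_nonneg hρ0 β) (mul_nonneg (sq_nonneg η) hc₂)

/-- **THE FAMILY FORM WITH `η_K ≤ (L^K)⁻¹`** — covers run B (level `K+1` problem at cutoff `K`, `η_K = (L^{K+1})⁻¹`)
as well as run A: same data as `holderReg_family_of_thm1At` with `heta : 0 ≤ η_K ≤ (L^K)⁻¹` and `0 ≤ Mc`; the
conclusion is again LITERALLY the body of `hA9`/`hB9`: `∀ K z, HolderReg ((ρ K).cfg (U K)) z 6 (L^K)⁻¹ (B₃Mcε₁)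
(B₃Mcε₁) β₀ (B₄Mcε₁)`. [folklore] -/
theorem holderReg_family_of_thm1At_le (L : ℕ) (fam : ℕ → VarProblem) (ρ : ∀ K, Realises (fam K) d 𝔸)
    (heta : ∀ K, 0 ≤ (fam K).eta ∧ (fam K).eta ≤ ((L : ℝ) ^ K)⁻¹) (C : B11Thm1.Consts)
    (hT : ∀ K, B11Thm1.Thm1At C (fam K))
    {ε₁ : ℝ} (hε₁ : 0 < ε₁) (hε₁a : ε₁ ≤ C.a₁) (V : ∀ K, (fam K).Bdry) (hV : ∀ K, (fam K).Reg7 ε₁ (V K))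
    (U : ∀ K, (fam K).Cfg) (hU : ∀ K, (fam K).OnMinimalOrbit (C.B₃ * ε₁) (V K) (U K))
    {Mc : ℝ} (hMc0 : 0 ≤ Mc) (hMc : Mc ≤ C.Mfun ε₁)
    (hcover : ∀ K (z : B7Prop1Explicit.Site d), ∃ c : (fam K).Cube,
      (fam K).L ^ (fam K).scale c * (fam K).eta = 1 ∧ (fam K).sizeM c ≤ Mc ∧
        l1 (z - (ρ K).centre c) + 6 ≤ (ρ K).radius c)
    {β₀ : ℝ} (hβ₀ : 0 ≤ β₀) (hβ₀1 : β₀ ≤ 1) :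
    ∀ (K : ℕ) (z : B7Prop1Explicit.Site d),
      HolderReg ((ρ K).cfg (U K)) z 6 (((L : ℝ) ^ K)⁻¹) (C.B₃ * Mc * ε₁) (C.B₃ * Mc * ε₁) β₀ (C.B₄ * Mc * ε₁) := by
  intro K z
  have h := holderReg_everySite_of_thm1At (ρ K) (heta K).1 C (hT K) hε₁ hε₁a (hV K) (hU K) hMc (hcover K) hβ₀
    hβ₀1 z
  have hB₃ : 0 ≤ C.B₃ * Mc * ε₁ := mul_nonneg (mul_nonneg C.B₃_pos.le hMc0) hε₁.le
  have hB₄ : 0 ≤ C.B₄ * Mc * ε₁ := mul_nonneg (mul_nonneg C.B₄_pos.le hMc0) hε₁.le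
  exact h.mono_eta (heta K).1 (heta K).2 hB₃ hB₃ hβ₀ hB₄

end RunB

end Summit.QuantumFields.BalabanUV.T4Continuum.TermwiseHolder
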